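import Mathlib
import Summits.ValiantsHypothesis.ValiantsHypothesis.Theorems.LacunarySymmetroidMatrixDescartesGramDual
import Summits.ValiantsHypothesis.ValiantsHypothesis.Theorems.LacunarySymmetroidMatrixDescartesGramDualFrame
import Summits.ValiantsHypothesis.ValiantsHypothesis.Theorems.LacunarySymmetroidMatrixDescartesGramDualSigned

/-!
# `MatrixDescartes` (stmt-ValiantsHypothesis-18050) — Gram duality, part 9: the SPLITTING LAW FOR FAMILIES
# (pairwise `B⁻¹`-orthogonal letter groups are additive) and the ONE-LETTER BOUND (`Z₊(X^eB + X^dS) ≤ #columns`)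

HONEST FRAMING.  Cell `pub-symmetroid`, seat `val-sym-mdr-p2` (gen 19); helper file `--supports` the crux
`Theses.LacunarySymmetroid.MatrixDescartes` (OPEN), NO closure claim; companion of `…GramDualSigned` (signed Gram
duality, binary splitting law).  Sector laws; nothing here bears on the crux in its window, `stub_twoSided`,
`DoorA26` / `DoorA34`, registers, or `VP ≠ VNP`.

* **`card_posRoots_family_le` (SPLITTING LAW FOR FAMILIES).**  `det B ≠ 0`; a finite family of signed column groups
  `U k : ι × ρ₀` (`k : γ`, common column type `ρ₀`; signs `σ k j ≠ 0`, exponents `δ k j` arbitrary) with PAIRWISE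
  `B⁻¹`-ORTHOGONAL ranges (`(U k)ᵀB⁻¹(U k') = 0`, `k ≠ k'`) satisfies
  `Z₊(X^eB + Σₖ U_k diag(σ_kX^{δ_k}) U_kᵀ) ≤ Σₖ Z₊(X^eB + U_k diag(σ_kX^{δ_k}) U_kᵀ)`
  (the dual of the juxtaposed system is BLOCK-DIAGONAL: `dual_family_eq_blockDiagonal`, Mathlib `det_blockDiagonal`).
* **`card_posRoots_oneLetter_le` (ONE-LETTER BOUND).**  `det B ≠ 0`, `σⱼ ≠ 0`, ONE exponent `d` for all columns:
  `Z₊(X^eB + U diag(σX^d) Uᵀ) ≤ card ρ₀` — a two-term word has at most as many positive zeros as letter columns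
  (its dual is `diag(σ⁻¹)X^{E−d} + X^{E−e}C`, a polynomial in ONE monomial of degree `≤ card ρ₀` composed with a power).
* **`card_posRoots_orthogonalLetters_le` (PAIRWISE `B⁻¹`-ORTHOGONAL LETTERS).**  Letters `S_k = U_k diag(σ_k) U_kᵀ`
  (one exponent `d_k` each) with pairwise `B⁻¹`-orthogonal column systems ⇒ `Z₊ ≤ card γ · card ρ₀` (= total number of
  letter columns) — `K`-free per letter and independent of the size and of the exponents: each letter pays at most
  its column count, however the exponents interleave around the base.

[folklore] (block determinants, Sylvester, degree count).  Axioms `propext`, `Classical.choice`, `Quot.sound`.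
-/

-- layout Summits/ValiantsHypothesis/ValiantsHypothesis forces the duplicated namespace component
set_option linter.dupNamespace false

namespace Summit.ValiantsHypothesis.ValiantsHypothesis.Theorems.LacunarySymmetroidMatrixDescartes

open Polynomial Matrix Finset
open scoped BigOperators

namespace GramDual

variable {ι ρ₀ γ : Type*} [Fintype ι] [DecidableEq ι] [Fintype ρ₀] [DecidableEq ρ₀] [Fintype γ] [DecidableEq γ]

/-- the signed column part (file-local notation, as in `…GramDualSigned`) -/
local notation3 (prettyPrint := false) "𝕊[" U ", " σ ", " δ "]" =>
  ((U : Matrix _ _ ℝ).map Polynomial.C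
      * Matrix.diagonal (fun j => Polynomial.C ((σ : _ → ℝ) j) * (Polynomial.X : Polynomial ℝ) ^ (δ j : ℕ))
      * ((U : Matrix _ _ ℝ).map Polynomial.C)ᵀ)

/-- the signed primal word (file-local notation, as in `…GramDualSigned`) -/
local notation3 (prettyPrint := false) "𝔽ₛ[" e ", " B ", " U ", " σ ", " δ "]" =>
  (((Polynomial.X : Polynomial ℝ) ^ (e : ℕ)) • (B : Matrix _ _ ℝ).map Polynomial.C + 𝕊[U, σ, δ])

/-- the signed dual word (file-local notation, as in `…GramDualSigned`) -/
local notation3 (prettyPrint := false) "𝔻ₛ[" E ", " e ", " B ", " U ", " σ ", " δ "]" =>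
  (Matrix.diagonal (fun j => Polynomial.C (((σ : _ → ℝ) j)⁻¹) * (Polynomial.X : Polynomial ℝ) ^ ((E : ℕ) - δ j))
    + ((Polynomial.X : Polynomial ℝ) ^ ((E : ℕ) - (e : ℕ))) •
      ((U : Matrix _ _ ℝ)ᵀ * (B : Matrix _ _ ℝ)⁻¹ * (U : Matrix _ _ ℝ)).map Polynomial.C)

/-! ## §1  Juxtaposing a family of column groups -/

omit [Fintype ι] [DecidableEq ι] in
/-- **A family of signed column groups is one column system on `ρ₀ × γ`.** [folklore] -/
theorem family_eq_signedPart (U : γ → Matrix ι ρ₀ ℝ) (σ : γ → ρ₀ → ℝ) (δ : γ → ρ₀ → ℕ) :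
    (∑ k, 𝕊[U k, σ k, δ k])
      = 𝕊[(Matrix.of fun (i : ι) (jk : ρ₀ × γ) => U jk.2 i jk.1), (fun jk : ρ₀ × γ => σ jk.2 jk.1),
          (fun jk : ρ₀ × γ => δ jk.2 jk.1)] := by
  refine Matrix.ext fun i i' => ?_
  have hL : (∑ k, 𝕊[U k, σ k, δ k]) i i' = ∑ k, ∑ j, Polynomial.C (U k i j)
      * (Polynomial.C (σ k j) * (Polynomial.X : Polynomial ℝ) ^ δ k j) * Polynomial.C (U k i' j) := by
    rw [Matrix.sum_apply]
    refine Finset.sum_congr rfl fun k _ => ?_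
    rw [Matrix.mul_apply]
    refine Finset.sum_congr rfl fun j _ => ?_
    rw [Matrix.mul_diagonal, Matrix.transpose_apply, Matrix.map_apply, Matrix.map_apply]
  have hR : (𝕊[(Matrix.of fun (i : ι) (jk : ρ₀ × γ) => U jk.2 i jk.1), (fun jk : ρ₀ × γ => σ jk.2 jk.1),
      (fun jk : ρ₀ × γ => δ jk.2 jk.1)]) i i'
      = ∑ jk : ρ₀ × γ, Polynomial.C (U jk.2 i jk.1)
          * (Polynomial.C (σ jk.2 jk.1) * (Polynomial.X : Polynomial ℝ) ^ δ jk.2 jk.1) * Polynomial.C (U jk.2 i' jk.1) := by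
    rw [Matrix.mul_apply]
    refine Finset.sum_congr rfl fun jk _ => ?_
    rw [Matrix.mul_diagonal, Matrix.transpose_apply, Matrix.map_apply, Matrix.map_apply, Matrix.of_apply,
      Matrix.of_apply]
  rw [hL, hR, Fintype.sum_prod_type_right]

omit [DecidableEq γ] [Fintype γ] [DecidableEq ρ₀] [Fintype ρ₀] in
/-- Gram matrix of the juxtaposed family: block `(k, k')` is `(U k)ᵀB⁻¹(U k')`. [folklore] -/
theorem gram_family (B : Matrix ι ι ℝ) (U : γ → Matrix ι ρ₀ ℝ) (jk jk' : ρ₀ × γ) :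
    ((Matrix.of fun (i : ι) (jk : ρ₀ × γ) => U jk.2 i jk.1)ᵀ * B⁻¹
        * (Matrix.of fun (i : ι) (jk : ρ₀ × γ) => U jk.2 i jk.1)) jk jk'
      = ((U jk.2)ᵀ * B⁻¹ * U jk'.2) jk.1 jk'.1 := by
  simp only [Matrix.mul_apply, Matrix.transpose_apply, Matrix.of_apply]

omit [Fintype ρ₀] [Fintype γ] in
/-- **Pairwise orthogonal groups ⇒ block-diagonal dual.** [folklore] -/
theorem dual_family_eq_blockDiagonal (E e : ℕ) (B : Matrix ι ι ℝ) (U : γ → Matrix ι ρ₀ ℝ) (σ : γ → ρ₀ → ℝ)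
    (δ : γ → ρ₀ → ℕ) (horth : ∀ k k', k ≠ k' → (U k)ᵀ * B⁻¹ * U k' = 0) :
    𝔻ₛ[E, e, B, (Matrix.of fun (i : ι) (jk : ρ₀ × γ) => U jk.2 i jk.1), (fun jk : ρ₀ × γ => σ jk.2 jk.1),
        (fun jk : ρ₀ × γ => δ jk.2 jk.1)]
      = Matrix.blockDiagonal fun k => 𝔻ₛ[E, e, B, U k, σ k, δ k] := by
  refine Matrix.ext fun jk jk' => ?_
  obtain ⟨j, k⟩ := jk
  obtain ⟨j', k'⟩ := jk'
  rw [Matrix.blockDiagonal_apply]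
  simp only [Matrix.add_apply, Matrix.diagonal_apply, Matrix.smul_apply, Matrix.map_apply, smul_eq_mul,
    gram_family, Prod.mk.injEq]
  by_cases hk : k = k'
  · subst hk
    simp only [and_true, if_true]
  · rw [if_neg (fun h => hk h.2), if_neg hk, horth k k' hk, Matrix.zero_apply, map_zero, mul_zero, add_zero]

/-! ## §2  The splitting law for families -/

/-- **SPLITTING LAW FOR FAMILIES.**  `det B ≠ 0`, signs non-zero, column groups with PAIRWISE `B⁻¹`-orthogonal
ranges ⇒ `Z₊(X^eB + Σₖ U_k diag(σ_kX^{δ_k}) U_kᵀ) ≤ Σₖ Z₊(X^eB + U_k diag(σ_kX^{δ_k}) U_kᵀ)`.  All sizes, all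
exponents (both sides of `e`), all signs; `B` need not be symmetric. [folklore] -/
theorem card_posRoots_family_le (B : Matrix ι ι ℝ) (hB : IsUnit B.det) (U : γ → Matrix ι ρ₀ ℝ)
    (σ : γ → ρ₀ → ℝ) (hσ : ∀ k j, σ k j ≠ 0) (e : ℕ) (δ : γ → ρ₀ → ℕ)
    (horth : ∀ k k', k ≠ k' → (U k)ᵀ * B⁻¹ * U k' = 0) :
    ((Matrix.det (((Polynomial.X : Polynomial ℝ) ^ e) • B.map Polynomial.C + ∑ k, 𝕊[U k, σ k, δ k])
        ).roots.toFinset.filter (fun t => 0 < t)).card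
      ≤ ∑ k, ((Matrix.det (𝔽ₛ[e, B, U k, σ k, δ k])).roots.toFinset.filter (fun t => 0 < t)).card := by
  classical
  obtain ⟨E, he, hδ⟩ := exists_bound e (fun jk : ρ₀ × γ => δ jk.2 jk.1)
  have hδk : ∀ k j, δ k j ≤ E := fun k j => hδ (j, k)
  have hσ' : ∀ jk : ρ₀ × γ, σ jk.2 jk.1 ≠ 0 := fun jk => hσ jk.2 jk.1
  rw [family_eq_signedPart, posRoots_base_eq B hB _ _ hσ' e E _ he hδ, dual_family_eq_blockDiagonal E e B U σ δ horth,
    Matrix.det_blockDiagonal]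
  refine (card_posRoots_prod_le _ _).trans (Finset.sum_le_sum fun k _ => ?_)
  rw [← posRoots_base_eq B hB (U k) (σ k) (hσ k) e E (δ k) he (hδk k)]

/-! ## §3  The one-letter bound -/

omit [Fintype ι] [DecidableEq ι] [Fintype ρ₀] [DecidableEq ρ₀] in
/-- Composing with `X^n` entrywise: `(X • P + Q).map (· ∘ X^n) = X^n • P + Q` (constant matrices `P`, `Q`).
[folklore] -/
theorem map_comp_X_pow (P Q : Matrix ρ₀ ρ₀ ℝ) (n : ℕ) :
    ((Polynomial.X : Polynomial ℝ) • P.map Polynomial.C + Q.map Polynomial.C).map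
        (Polynomial.compRingHom ((Polynomial.X : Polynomial ℝ) ^ n))
      = ((Polynomial.X : Polynomial ℝ) ^ n) • P.map Polynomial.C + Q.map Polynomial.C := by
  refine Matrix.ext fun i j => ?_
  simp only [Matrix.map_apply, Matrix.add_apply, Matrix.smul_apply, smul_eq_mul, Polynomial.coe_compRingHom,
    Polynomial.add_comp, Polynomial.mul_comp, Polynomial.X_comp, Polynomial.C_comp]

omit [Fintype ι] [DecidableEq ι] in
/-- `det(X^n • P + Q) = (det(X • P + Q)) ∘ X^n`. [folklore] -/
theorem det_X_pow_smul_add (P Q : Matrix ρ₀ ρ₀ ℝ) (n : ℕ) :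
    Matrix.det (((Polynomial.X : Polynomial ℝ) ^ n) • P.map Polynomial.C + Q.map Polynomial.C)
      = (Matrix.det ((Polynomial.X : Polynomial ℝ) • P.map Polynomial.C + Q.map Polynomial.C)).comp
          ((Polynomial.X : Polynomial ℝ) ^ n) := by
  have h := RingHom.map_det (Polynomial.compRingHom ((Polynomial.X : Polynomial ℝ) ^ n))
    ((Polynomial.X : Polynomial ℝ) • P.map Polynomial.C + Q.map Polynomial.C)
  rw [RingHom.mapMatrix_apply, map_comp_X_pow, Polynomial.coe_compRingHom_apply] at h
  exact h.symm

omit [Fintype ι] [DecidableEq ι] in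
/-- **Degree count**: `det(X^n • P + Q)` (`n ≥ 1`) has at most `card ρ₀` distinct positive zeros. [folklore] -/
theorem card_posRoots_det_X_pow_smul_add_le (P Q : Matrix ρ₀ ρ₀ ℝ) {n : ℕ} (hn : 0 < n) :
    ((Matrix.det (((Polynomial.X : Polynomial ℝ) ^ n) • P.map Polynomial.C + Q.map Polynomial.C)
        ).roots.toFinset.filter (fun t => 0 < t)).card ≤ Fintype.card ρ₀ := by
  classical
  set q : Polynomial ℝ := Matrix.det ((Polynomial.X : Polynomial ℝ) • P.map Polynomial.C + Q.map Polynomial.C)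
    with hq
  rw [det_X_pow_smul_add]
  by_cases hq0 : q = 0
  · rw [← hq, hq0, Polynomial.zero_comp, Polynomial.roots_zero, Multiset.toFinset_zero, Finset.filter_empty,
      Finset.card_empty]
    exact Nat.zero_le _
  have hdeg : q.natDegree ≤ Fintype.card ρ₀ := Polynomial.natDegree_det_X_add_C_le P Q
  -- positive zeros of `q ∘ X^n` inject into the zeros of `q` under `t ↦ t^n`
  have hinj : Set.InjOn (fun t : ℝ => t ^ n)
      ↑((q.comp ((Polynomial.X : Polynomial ℝ) ^ n)).roots.toFinset.filter (fun t => 0 < t)) := by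
    intro a ha b hb hab
    simp only [Finset.coe_filter, Set.mem_setOf_eq] at ha hb
    exact (pow_left_inj₀ ha.2.le hb.2.le hn.ne').1 hab
  have hmaps : ∀ t ∈ (q.comp ((Polynomial.X : Polynomial ℝ) ^ n)).roots.toFinset.filter (fun t => 0 < t),
      (fun t : ℝ => t ^ n) t ∈ q.roots.toFinset := by
    intro t ht
    rw [Finset.mem_filter, Multiset.mem_toFinset, Polynomial.mem_roots', Polynomial.IsRoot.def,
      Polynomial.eval_comp, Polynomial.eval_pow, Polynomial.eval_X] at ht
    rw [Multiset.mem_toFinset, Polynomial.mem_roots', Polynomial.IsRoot.def]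
    exact ⟨hq0, ht.1.2⟩
  calc ((q.comp ((Polynomial.X : Polynomial ℝ) ^ n)).roots.toFinset.filter (fun t => 0 < t)).card
      ≤ q.roots.toFinset.card := Finset.card_le_card_of_injOn _ hmaps hinj
    _ ≤ q.roots.card := Multiset.toFinset_card_le _
    _ ≤ q.natDegree := Polynomial.card_roots' q
    _ ≤ Fintype.card ρ₀ := hdeg

omit [Fintype ι] [DecidableEq ι] in
/-- A monomial multiple has the same positive zeros: `Z₊(X^a · p) = Z₊(p)`. [folklore] -/
theorem posRoots_X_pow_mul (p : Polynomial ℝ) (a : ℕ) :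
    (((Polynomial.X : Polynomial ℝ) ^ a * p).roots.toFinset.filter (fun t => 0 < t))
      = (p.roots.toFinset.filter (fun t => 0 < t)) := by
  classical
  by_cases hp : p = 0
  · rw [hp, mul_zero]
  ext t
  simp only [Finset.mem_filter, Multiset.mem_toFinset, Polynomial.mem_roots', Polynomial.IsRoot.def,
    Polynomial.eval_mul, Polynomial.eval_pow, Polynomial.eval_X, mul_eq_zero]
  constructor
  · rintro ⟨⟨-, h⟩, ht⟩
    rcases h with h | h
    · exact absurd (pow_eq_zero_iff'.1 h).1 ht.ne'
    · exact ⟨⟨hp, h⟩, ht⟩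
  · rintro ⟨⟨-, h⟩, ht⟩
    exact ⟨⟨mul_ne_zero (pow_ne_zero _ Polynomial.X_ne_zero) hp, Or.inr h⟩, ht⟩

/-- **THE ONE-LETTER BOUND.**  `det B ≠ 0`, signs `σⱼ ≠ 0`, ONE exponent `d` for all columns:
`Z₊(X^eB + U diag(σX^d) Uᵀ) ≤ card ρ₀` (a two-term word has at most as many positive zeros as letter columns;
none at all when `d = e`). [folklore] -/
theorem card_posRoots_oneLetter_le (B : Matrix ι ι ℝ) (hB : IsUnit B.det) (U : Matrix ι ρ₀ ℝ) (σ : ρ₀ → ℝ)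
    (hσ : ∀ j, σ j ≠ 0) (e d : ℕ) :
    ((Matrix.det (𝔽ₛ[e, B, U, σ, (fun _ : ρ₀ => d)])).roots.toFinset.filter (fun t => 0 < t)).card
      ≤ Fintype.card ρ₀ := by
  classical
  -- dual with `E = e + d`: `diag(σ⁻¹)·X^e + X^d·C`
  have he : e ≤ e + d := Nat.le_add_right _ _
  have hδ : ∀ _j : ρ₀, d ≤ e + d := fun _ => Nat.le_add_left _ _
  rw [posRoots_base_eq B hB U σ hσ e (e + d) (fun _ => d) he hδ, Nat.add_sub_cancel, Nat.add_sub_cancel_left]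
  set Cm : Matrix ρ₀ ρ₀ ℝ := Uᵀ * B⁻¹ * U with hCm
  set Dg : Matrix ρ₀ ρ₀ ℝ := Matrix.diagonal fun j => (σ j)⁻¹ with hDg
  have hdiag : Matrix.diagonal (fun j => Polynomial.C ((σ j)⁻¹) * (Polynomial.X : Polynomial ℝ) ^ e)
      = ((Polynomial.X : Polynomial ℝ) ^ e) • Dg.map Polynomial.C := by
    refine Matrix.ext fun i j => ?_
    simp only [Matrix.diagonal_apply, Matrix.smul_apply, Matrix.map_apply, hDg, smul_eq_mul]
    split_ifs with h
    · ring
    · rw [map_zero, mul_zero]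
  rw [hdiag]
  rcases lt_trichotomy d e with hlt | heq | hgt
  · -- `d < e`: `X^e Dg + X^d Cm = X^d (X^{e-d} Dg + Cm)`
    obtain ⟨n, hn⟩ := Nat.exists_eq_add_of_lt hlt
    have hne : 0 < n + 1 := Nat.succ_pos _
    have hfac : ((Polynomial.X : Polynomial ℝ) ^ e) • Dg.map Polynomial.C
          + ((Polynomial.X : Polynomial ℝ) ^ d) • Cm.map Polynomial.C
        = ((Polynomial.X : Polynomial ℝ) ^ d) • (((Polynomial.X : Polynomial ℝ) ^ (n + 1)) • Dg.map Polynomial.C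
            + Cm.map Polynomial.C) := by
      rw [smul_add, smul_smul, ← pow_add, hn, ← Nat.add_assoc]
    rw [hfac, Matrix.det_smul, ← pow_mul, posRoots_X_pow_mul]
    exact card_posRoots_det_X_pow_smul_add_le Dg Cm hne
  · -- `d = e`: a monomial times a constant
    subst heq
    have hsum : Dg.map Polynomial.C + Cm.map Polynomial.C = (Dg + Cm).map Polynomial.C :=
      (Matrix.map_add _ (fun a b => map_add Polynomial.C a b) Dg Cm).symm
    rw [← smul_add, Matrix.det_smul, ← pow_mul, hsum, posRoots_X_pow_mul]
    have h := (RingHom.map_det (Polynomial.C : ℝ →+* Polynomial ℝ) (Dg + Cm)).symm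
    rw [RingHom.mapMatrix_apply] at h
    rw [h, Finset.card_eq_zero.2]
    · exact Nat.zero_le _
    · rw [Finset.filter_eq_empty_iff]
      intro t ht hpos
      rw [Multiset.mem_toFinset, Polynomial.mem_roots', Polynomial.IsRoot.def, Polynomial.eval_C] at ht
      exact ht.1 (by rw [ht.2, map_zero])
  · -- `e < d`: `X^e Dg + X^d Cm = X^e (X^{d-e} Cm + Dg)`
    obtain ⟨n, hn⟩ := Nat.exists_eq_add_of_lt hgt
    have hne : 0 < n + 1 := Nat.succ_pos _
    have hfac : ((Polynomial.X : Polynomial ℝ) ^ e) • Dg.map Polynomial.C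
          + ((Polynomial.X : Polynomial ℝ) ^ d) • Cm.map Polynomial.C
        = ((Polynomial.X : Polynomial ℝ) ^ e) • (((Polynomial.X : Polynomial ℝ) ^ (n + 1)) • Cm.map Polynomial.C
            + Dg.map Polynomial.C) := by
      rw [smul_add, smul_smul, ← pow_add, hn, ← Nat.add_assoc,
        add_comm (((Polynomial.X : Polynomial ℝ) ^ e) • Dg.map Polynomial.C)]
    rw [hfac, Matrix.det_smul, ← pow_mul, posRoots_X_pow_mul]
    exact card_posRoots_det_X_pow_smul_add_le Cm Dg hne

/-! ## §4  Pairwise `B⁻¹`-orthogonal letters -/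

/-- **PAIRWISE `B⁻¹`-ORTHOGONAL LETTERS.**  `det B ≠ 0`; letters `S_k = U_k diag(σ_k) U_kᵀ` (`U_k : ι × ρ₀`,
`σ_k j ≠ 0`) at ONE exponent `d_k` each, with pairwise `B⁻¹`-orthogonal column systems
(`(U k)ᵀB⁻¹(U k') = 0`, `k ≠ k'`): `Z₊(X^eB + Σₖ X^{d_k} S_k) ≤ card γ · card ρ₀` — each letter pays at most its
number of columns, whatever the size and however the exponents `d_k` sit around `e`. [folklore] -/
theorem card_posRoots_orthogonalLetters_le (B : Matrix ι ι ℝ) (hB : IsUnit B.det) (U : γ → Matrix ι ρ₀ ℝ)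
    (σ : γ → ρ₀ → ℝ) (hσ : ∀ k j, σ k j ≠ 0) (e : ℕ) (d : γ → ℕ)
    (horth : ∀ k k', k ≠ k' → (U k)ᵀ * B⁻¹ * U k' = 0) :
    ((Matrix.det (((Polynomial.X : Polynomial ℝ) ^ e) • B.map Polynomial.C
        + ∑ k, 𝕊[U k, σ k, (fun _ : ρ₀ => d k)])).roots.toFinset.filter (fun t => 0 < t)).card
      ≤ Fintype.card γ * Fintype.card ρ₀ := by
  classical
  refine (card_posRoots_family_le B hB U σ hσ e (fun k _ => d k) horth).trans ?_
  calc ∑ k, ((Matrix.det (𝔽ₛ[e, B, U k, σ k, (fun _ : ρ₀ => d k)])).roots.toFinset.filter (fun t => 0 < t)).card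
      ≤ ∑ _k : γ, Fintype.card ρ₀ :=
        Finset.sum_le_sum fun k _ => card_posRoots_oneLetter_le B hB (U k) (σ k) (hσ k) e (d k)
    _ = Fintype.card γ * Fintype.card ρ₀ := by rw [Finset.sum_const, Finset.card_univ, smul_eq_mul]

end GramDual

end Summit.ValiantsHypothesis.ValiantsHypothesis.Theorems.LacunarySymmetroidMatrixDescartes
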